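import Summits.Parity.BatemanHorn.Theses.IsogenyRedei
import Literature.NumberTheory.EllipticCurves.TwoIsogenySelmerGroupProofs
import Summits.Parity.BatemanHorn.Theorems.IsogenyRedeiPencilSelmerDictionaryBSideOddPlaces
import Summits.Parity.BatemanHorn.Theorems.IsogenyRedeiPencilSelmerDictionaryDualSideOddPlaces
import Summits.Parity.BatemanHorn.Theorems.IsogenyRedeiPencilSelmerDictionaryBSideTwoAdic
import Summits.Parity.BatemanHorn.Theorems.IsogenyRedeiPencilSelmerDictionaryDualSideTwoAdic
import Summits.Parity.BatemanHorn.Theorems.IsogenyRedeiPencilSelmerDictionaryKernelCount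
import Literature.NumberTheory.EllipticCurves.ShaIsogenyProofs
import Literature.NumberTheory.EllipticCurves.BSDSha
import Literature.NumberTheory.EllipticCurves.TwoIsogenyCasselsParity
import HarnessLib.Audit

/-!
# Line `toric-node-vacuity-cassels` — crux `PencilSelmerDictionary` (stmt-Parity-11584, route IsogenyRedei)

Crux (route decl, fixed): `∃ M, ∃ w : ℕ → ℤ, (∀ t, w (t + 2^M) = w t) ∧ ∀ t ≥ 1,
(-1)^{corank_{ℤ₂} Sel_{2^∞}(E_t/ℚ)} = -(w t · (-1)^{#odd p ∣ t²+1})`, `E_t = ⟨0, 2t, 0, t²+1, 0⟩`.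

Idea (card `Ideas/toric-node-vacuity-cassels.md`, triage r1: 3 × pass, merged with
`cassels-local-images-mod4` / `cassels-pair-split-fibres`): `E_t : y² = x(x² + 2t x + t²+1)` carries the
2-isogeny with kernel `T = (0,0)` whose dual descent locus `b′ = (2t)² − 4(t²+1) = −4` is CONSTANT. At every
odd `p ∣ t²+1` the fibre is a SPLIT node and `T` reduces to the node, so in the tree's EXPLICIT isogeny
Selmer sets (`twoIsogenySelmerGroup`, Silverman X.4.9) the odd primes impose NO condition on the descent on
the divisors of `b = t²+1` (`stub_bSideOddPlaces`) and exactly "`d` is a square mod `p`" on the descent on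
the divisors of `b′ = −4` (`stub_dualSideOddPlaces`); the real place kills `d < 0` on the `b`-side
(`real_obstruction`, proved here); the place `2` is a finite table in `t mod 8` (`stub_bSideTwoAdic`,
`stub_dualSideTwoAdic`). Counting the resulting explicit `𝔽₂`-subspaces (`stub_twoAdicKernelCount`, pure
arithmetic of squarefree divisors of `t²+1`) gives `dim S + dim S′ ≡ ω_odd(t²+1) + [t % 4 ≥ 2] (mod 2)`,
and the ONE deep import, Cassels' formula for the 2-isogeny in parity form (tree NAMED FACT
`cassels_selmerCorank_two_parity`, restricted to the pencil: `stub_casselsPencil`, one line from the fact —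
`casselsPencil_of_fact` below), turns this into the crux with the SHARP witness `M = 2`,
`w t = -1 (t ≡ 0,1 mod 4), +1 (t ≡ 2,3 mod 4)` — the table forced by the disprover's
`Descent.forced_w_values_upto_eight` (Disproof.lean §4b; `M ≤ 1` refuted there).

Shape (A12): six registered stubs `stub_*` (the only `sorry`s), the fully proved composition
`dictionary_of_localData` (hypotheses = the six stub statements verbatim, conclusion = the pointwise
identity), and `PencilSelmerDictionary_of : PencilSelmerDictionary` (concludes the crux BY NAME, no
hypotheses; uses the stubs as constants). Disproof used: §1 `iff_periodic` (we prove the periodicity with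
`M = 2`), §4b forced table (our `w`), §3b `w₃`-gap does not arise (no root numbers anywhere); the single
unavoidable import (`_false_without_` in spirit, triage r1-3) is Cassels/Cassels–Tate, used ONLY at
`stub_casselsPencil`.
-/

noncomputable section

open scoped Classical

namespace Summit.Parity.BatemanHorn.Cruxes.PencilSelmerDictionary.ToricNodeVacuityCassels

open Literature.NumberTheory.EllipticCurves
open Summit.Parity.BatemanHorn.Theses.IsogenyRedei (PencilSelmerDictionary)

/-! ## The six stubs (registered obligations; `sorry` lives only here) -/

/-- **Stub A — split-node vacuity, `b`-side odd places** (the idea's lever). For `t ≥ 1`, a positive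
squarefree `d ∣ t²+1` and ANY odd prime `p`, the homogeneous space
`w² = d u⁴ + 2t u²z² + ((t²+1)/d) z⁴` has a `ℚ_p`-point. Content: at `p ∣ t²+1` the reduction is
`w² ≡ u²(d u² + 2t z²)` (or the `d ↔ d′` mirror, or `2t u²z²` when `p` divides both), `2t` and `−2t` are
squares mod `p` (`p ≡ 1 (4)`, `t` of order `4`), so either `d` is a QR and `(1:0:√d)` lifts, or the conic
`s² − d u² = 2t` has `p − 1 ≥ 4` points with `u s ≠ 0` and `(u:1:us)` is smooth — Hensel
(`BinaryQuartic.isSoluble_of_unit_square_value`); at `p ∤ t²+1`: `disc = 256 (t²+1)` so `p ≥ 5` is the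
tree's `isSoluble_padic_of_not_dvd_disc`, and `p = 3` (never divides `t²+1`) by a unit square value at
`(1,0)`, `(0,1)` or `(1,1)`. Size M. Sources: Klagsbrun arXiv:1201.5408 §10 (split multiplicative lemma),
DokchitserDokchitser2011Crelle Thm 30, SilvermanAEC2009 X.4.9; numerics kit j010573 (0/2998 classes cut),
triage j010879. -/
theorem stub_bSideOddPlaces :
    ∀ t : ℕ, 1 ≤ t → ∀ d : ℤ, 0 < d → Squarefree d → d ∣ (t : ℤ) ^ 2 + 1 →
      ∀ (p : ℕ) [Fact p.Prime], p ≠ 2 →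
        ((twoIsogenyQuartic (2 * (t : ℤ)) d (((t : ℤ) ^ 2 + 1) / d)).map
          (Int.castRingHom ℚ_[p])).IsSoluble :=
  Summit.Parity.BatemanHorn.Theorems.PencilSelmerDictionary.stub_bSideOddPlaces

/-- **Stub B — square rule at the split node, dual side, odd places.** For `t ≥ 1` and an odd prime `p`,
the homogeneous space of the class `d = 2` of the descent on the divisors of `b′ = −4`,
`w² = 2u⁴ − 4t u²z² − 2z⁴`, is `ℚ_p`-soluble iff (`p ∣ t²+1 → p ≡ 1 (mod 8)`). Content:
`2u⁴ − 4t u²z² − 2z⁴ = 2(u² − t z²)² − 2(t²+1) z⁴ ≡ 2(u² − t z²)² (mod p)` for `p ∣ t²+1`; `u² ≡ t z²` is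
impossible for primitive `(u,z)` unless `t` is a square mod `p`, i.e. `p ≡ 1 (8)`; so soluble ⇒ `2` is a QR
⇒ `p ≡ ±1 (8)`, and `p ≡ 1 (4)` (as `p ∣ t²+1`, `ZMod.exists_sq_eq_neg_one_iff`) gives `p ≡ 1 (8)`;
conversely `(1:0:√2)` lifts (`ZMod.exists_sq_eq_two_iff` + Hensel). For `p ∤ t²+1`:
`disc = −2¹⁴ (t²+1)²`, good reduction (`isSoluble_padic_of_not_dvd_disc` for `p ≥ 5`; `p = 3`:
value `−2 ≡ 1` at `(0,1)`). Size M. Sources: SilvermanAEC2009 X.4.9, Klagsbrun arXiv:1201.5408 Lemma 3.3 /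
§10; numerics j010573 (S′ rule 1728/1728), selmer_sets.py (360/360). -/
theorem stub_dualSideOddPlaces :
    ∀ t : ℕ, 1 ≤ t → ∀ (p : ℕ) [Fact p.Prime], p ≠ 2 →
      (((twoIsogenyQuartic (-4 * (t : ℤ)) 2 (-2)).map (Int.castRingHom ℚ_[p])).IsSoluble ↔
        (p ∣ t ^ 2 + 1 → p % 8 = 1)) :=
  Summit.Parity.BatemanHorn.Theorems.PencilSelmerDictionary.stub_dualSideOddPlaces

/-- **Stub C — the 2-adic table, `b`-side** (hardest workable stub). For `t ≥ 1` and a positive squarefree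
`d ∣ t²+1` (so the odd part of `d` is `≡ 1 (mod 4)` and `d` is even only for `t` odd), `ℚ₂`-solubility of
`w² = d u⁴ + 2t u²z² + ((t²+1)/d) z⁴` is the displayed Boolean function of (`t mod 8`, class of `d` in
`ℚ₂ˣ/ℚ₂ˣ²` ∈ {1, 5, 2, 10}): class 1 (`d ≡ 1 (8)`: `d` is a 2-adic square) always; class 5 iff
`t ≡ 1, 2 (mod 4)`; class 2 (`d = 2m`, `m ≡ 1 (8)`) iff `t ≡ 1 (4)` or `t ≡ 7 (8)`; class 10 (`m ≡ 5 (8)`)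
iff `t ≡ 1 (4)` or `t ≡ 3 (8)`. Every SOLUBLE entry is a 2-adic square coefficient (`d` or `d′ ≡ 1 (8)`,
points `(1:0:√d)`, `(0:1:√d′)`) or a unit square VALUE at `(u,z) = (1,1)` (`≡ 1 mod 8`, then
`exists_sq_eq_of_norm_sub_lt`); every INSOLUBLE entry dies mod 16 after the valuation split
`(u,z) = (odd,odd) / (odd,even) / (even,odd)` (planner's hand check in the line card; cdisprove's
`not_isSoluble_padic_of_zmod` pattern, Disproof.lean §4b). Size L (≈ 14 residue cases). Sources:
SilvermanAEC2009 X.4.9/X.4.10; four independent numerics from the DEFINITIONS: j004946 (t ≤ 4000),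
j010573 (t ≤ 300), selmer_sets.py / j010879, cdisprove's 16 Lean Finsets (t ≤ 8). -/
theorem stub_bSideTwoAdic :
    ∀ t : ℕ, 1 ≤ t → ∀ d : ℤ, 0 < d → Squarefree d → d ∣ (t : ℤ) ^ 2 + 1 →
      (((twoIsogenyQuartic (2 * (t : ℤ)) d (((t : ℤ) ^ 2 + 1) / d)).map
          (Int.castRingHom ℚ_[2])).IsSoluble ↔
        ((d % 2 = 1 ∧ (d % 8 = 1 ∨ (d % 8 = 5 ∧ (t % 4 = 1 ∨ t % 4 = 2)))) ∨
          (d % 2 = 0 ∧ ((d / 2 % 8 = 1 ∧ (t % 4 = 1 ∨ t % 8 = 7)) ∨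
            (d / 2 % 8 = 5 ∧ (t % 4 = 1 ∨ t % 8 = 3)))))) :=
  Summit.Parity.BatemanHorn.Theorems.PencilSelmerDictionary.stub_bSideTwoAdic

/-- **Stub D — the 2-adic entry, dual side.** For `t ≥ 1`: `w² = 2u⁴ − 4t u²z² − 2z⁴` has a `ℚ₂`-point
iff `t ≡ 0 (mod 4)` or `t ≡ 7 (mod 8)`. Content (planner's hand analysis, line card §Stubs): mixed-parity
`(u,z)` give `v₂ = 1`; for `u, z` odd `Q = 2(u⁴ − z⁴) − 4t u²z²` with `16 ∣ u⁴ − z⁴`: `t` odd ⇒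
`Q/4 ≡ −t (mod 8)`, soluble iff `t ≡ 7 (8)` (point `(1,1)`, `w = 2√(−t)`); `t ≡ 2 (4)` ⇒ `v₂(Q) = 3`;
`t ≡ 4 (8)`: `z = 1`, `u ∈ {1,3,5,7}` chosen by `t/4 mod 8` gives `Q = 16·(1 mod 8)`; `t ≡ 8 (16)`:
`u = 1 + 4h₁`, `h₁` odd mod 16, gives `Q = 64·(1 mod 8)`; `t ≡ 0 (16)`: `u = 1 + 2h`, `h ≡ 3 (8)` chosen
mod 32, gives `Q = 64·(1 mod 8)`. Size M. Sources: SilvermanAEC2009 X.4.9; numerics j010573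
(I₂′ = I₂^⊥, |I₂||I₂′| = 8), cdisprove §4b (`±2` at `t = 4` global: `4² = 2·3⁴ − 16·3² − 2`; `±2 ∉ S′`
at `t = 1,2,3` mod 16/32). -/
theorem stub_dualSideTwoAdic :
    ∀ t : ℕ, 1 ≤ t →
      (((twoIsogenyQuartic (-4 * (t : ℤ)) 2 (-2)).map (Int.castRingHom ℚ_[2])).IsSoluble ↔
        (t % 4 = 0 ∨ t % 8 = 7)) :=
  Summit.Parity.BatemanHorn.Theorems.PencilSelmerDictionary.stub_dualSideTwoAdic

/-- **Stub E — counting the 2-adic kernel** (pure arithmetic, no solubility). For `t ≥ 1` the number of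
positive squarefree `d ∣ t²+1` passing the table of Stub C is `2^{ω(t²+1) − r(t)}` with `r = 1` iff
`t ≡ 3 (8)`, or (`t ≡ 0 (4)` or `t ≡ 7 (8)`) and some prime `p ∣ t²+1` is `≡ 5 (8)`; else `r = 0`.
Content: positive squarefree divisors of `n = t²+1` ↔ subsets of `n.primeFactors` (`2^ω` of them); every
odd prime factor is `≡ 1 (4)`, so the class of `d` in `{1,5,2,10}` is read off the parity of
`#{p ∣ d : p ≡ 5 (8)}` and `[2 ∣ d]`; per residue of `t` the table is the kernel of ≤ 1 nonzero
`𝔽₂`-character (`t ≡ 0 (4)`, `7 (8)`: `χ₅`, nonzero iff β; `t ≡ 3 (8)`: `χ₂ + χ₅`-type, always nonzero;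
`t ≡ 1, 2 (4)`: none), hence `2^{ω}` or `2^{ω−1}`. Size M (Finset bookkeeping:
`Nat.divisors_filter_squarefree`, characters on a powerset). Sources: folklore; card table "dim S = ω − r₂"
(j010573: 0 violations t ≤ 300; selmer_sets.py 60/60). -/
theorem stub_twoAdicKernelCount :
    ∀ t : ℕ, 1 ≤ t →
      ((Finset.Icc (1 : ℤ) ((t : ℤ) ^ 2 + 1)).filter (fun d : ℤ =>
          Squarefree d ∧ d ∣ (t : ℤ) ^ 2 + 1 ∧
            ((d % 2 = 1 ∧ (d % 8 = 1 ∨ (d % 8 = 5 ∧ (t % 4 = 1 ∨ t % 4 = 2)))) ∨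
              (d % 2 = 0 ∧ ((d / 2 % 8 = 1 ∧ (t % 4 = 1 ∨ t % 8 = 7)) ∨
                (d / 2 % 8 = 5 ∧ (t % 4 = 1 ∨ t % 8 = 3))))))).card =
        2 ^ ((t ^ 2 + 1).primeFactors.card -
          (if t % 8 = 3 ∨ ((t % 4 = 0 ∨ t % 8 = 7) ∧ ∃ p ∈ (t ^ 2 + 1).primeFactors, p % 8 = 5)
            then 1 else 0)) :=
  Summit.Parity.BatemanHorn.Theorems.PencilSelmerDictionary.stub_twoAdicKernelCount

/- (Former) **Stub F — Cassels' formula on the pencil (the line's ONE deep import).** For `t ≥ 1`: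
`(-1)^{corank_{ℤ₂} Sel_{2^∞}(E_t/ℚ)} = (-1)^{dim₂ S(2t, t²+1) + dim₂ S′(2t, t²+1)}`. This is VERBATIM the
tree's named fact `Literature.NumberTheory.EllipticCurves.cassels_selmerCorank_two_parity`
(Dokchitser–Dokchitser 2011 Thm 30 "Cassels' formula" + Cassels 1965 VIII / Klagsbrun Thm 3.5–3.6) at
`(a, b) = (2t, t²+1)` (`b(a² − 4b) = −4(t²+1) ≠ 0`) — see `casselsPencil_of_fact` below (proved, one
line + casts). NOT to be attacked directly by a stub worker: it closes the day the fact gets its `_holds`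
(Cassels–Tate / product formula; `blocked-on` that fact otherwise). It is the obstruction every line on
this crux shares (triage r1-3: "Cassels–Tate evenness enters exactly once"); this line uses it HERE and
nowhere else. Size XL (as a Lean theorem) / 0 (granted the fact). Sources: DokchitserDokchitser2011Crelle
Thm 30, Cassels1965ArithmeticVIII Thm 1.1, Klagsbrun2016 Thm 3.5–3.6, SilvermanAEC2009 X.4.9. -/
/-! ## Stub F decomposed (continuation lead c1, 2026-08-16): Cassels' parity from the Cassels–Tate pairing

STATUS 2026-08-16T12:30Z: F1–F4 are PROVED AND LANDED in the Literature library (F1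
`Literature/GroupTheory/FiniteAbelian/IsogenyPairParityFinite.lean` p98924, F2 `…/EllipticCurves/ZpCorankStable.lean`
p98446, F3 `…/IsogenyPairParity.lean` p99457, F4 `…/TwoIsogenyDualKernel.lean` p99051 + `…/CasselsTateIsogenyParity.lean`
p99900 + `…/TwoIsogenyCasselsParity.lean` p100425); their bodies below are one-line references. The ONLY `sorry` left is
F5 = the named fact `Literature.NumberTheory.EllipticCurves.casselsTate_pairing_functorial ℚ` (landed as a definition,
p100502), i.e. the crux is closed modulo the Cassels–Tate pairing (functorial form); the conditional closing theorem is
`Summit.Parity.BatemanHorn.Theorems.PencilSelmerDictionary.PencilSelmerDictionary_of_casselsTate_functorial`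
(`Theorems/IsogenyRedeiPencilSelmerDictionaryCT.lean`).

The named fact `cassels_selmerCorank_two_parity` is reduced in the tree
(`cassels_selmerCorank_two_parity_iff_sha_parity`, `two_pow_twoIsogenySelmerRank_add_eq`,
`natCard_sha_inf_range_twoIsogenyTorsorHom_eq`) to a statement about `Ш` alone:
`corank_{ℤ₂} Ш(E)[2^∞] ≡ dim₂ ker Ш(φ₀) + dim₂ ker Ш(φ_E) (mod 2)` for the two explicit `2`-isogenies
`φ₀ : V₀ → E`, `φ_E : E → E'`. In print this is the Cassels–Tate pairing: alternating, non-degenerate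
modulo divisible elements on `Ш(V₀)` and on `Ш(E)`, and ADJOINT for `(φ₀, φ̂₀)` (Milne, *ADT*, I.6.9,
I.6.13(a), Rem. I.6.10(a); for elliptic curves `E^t = E`, `φ^t = φ̂`, Silverman *AEC* III.6.1, X.4.14).
The four stubs below separate the GROUP THEORY (F1 finite level, F2 the corank of a stable `p`-primary
group, F3 the `p`-primary reduction — all provable now, no arithmetic) from the ARITHMETIC wrapper F4
(restriction to `Ш[2^∞]`, the dual isogeny, `ker Ш(φ̂₀) = ker Ш(φ_E)`, the half-model bookkeeping) and
the ONE residual deep input F5 = the Cassels–Tate pairing as a functorial family (the body of the named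
fact-to-be `casselsTate_pairing_functorial`, which implies the tree's `exists_casselsTate_pairing`). -/

section CasselsParity

open scoped AddSubgroup
open _root_.WeierstrassCurve

universe u v

/-- **Stub F1 — isogeny-pair parity at finite level.** `T, T'` finite abelian `p`-groups with
non-degenerate alternating pairings `b, b'` (values whose `p`-torsion embeds in `𝔽_p`), maps
`f : T → T'`, `g : T' → T` with `g ∘ f = p`, `f ∘ g = p`, adjoint (`b' (f x) y = b x (g y)`): then
`#ker f = p^m`, `#ker g = p^n` with `m + n` even. Proof in four lines: `#T = p^{2i}`, `#T' = p^{2i'}`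
(`Literature.GroupTheory.FiniteAbelian.exists_natCard_torsionBy_eq_pow_two_mul` + induction over
`T/T[p]` via `exists_quotTorsionPairing`); `ker f = {x : b x (g ·) = 0}` (adjointness + non-degeneracy of
`b'`); the `𝔽_p`-pairing `ker f × T/gT' → 𝔽_p`, `(x, [t]) ↦ ι (b x t)` has trivial left kernel, so
`#ker f · #gT' ≤ #T`, i.e. `#ker f · #T' ≤ #T · #ker g`; symmetrically `#ker g · #T ≤ #T' · #ker f`;
hence equality and `m + 2i' = n + 2i`. Size M. [folklore; the group theory behind Cassels' formula] -/
theorem stub_finiteLevel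
    {T T' : Type u} {Q : Type v} [AddCommGroup T] [AddCommGroup T'] [AddCommGroup Q]
    [Finite T] [Finite T'] (p : ℕ) [Fact p.Prime]
    (hT : ∀ t : T, ∃ n : ℕ, p ^ n • t = 0) (hT' : ∀ t : T', ∃ n : ℕ, p ^ n • t = 0)
    (ι : Q[(p : ℤ)] →+ ZMod p) (hι : Function.Injective ι)
    (b : T →+ T →+ Q) (b' : T' →+ T' →+ Q)
    (hb : ∀ x, b x x = 0) (hb' : ∀ y, b' y y = 0)
    (hbnd : ∀ x, (∀ y, b x y = 0) → x = 0) (hb'nd : ∀ x, (∀ y, b' x y = 0) → x = 0)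
    (f : T →+ T') (g : T' →+ T)
    (hgf : ∀ x, g (f x) = p • x) (hfg : ∀ y, f (g y) = p • y)
    (hadj : ∀ x y, b' (f x) y = b x (g y)) :
    ∃ m n : ℕ, Nat.card f.ker = p ^ m ∧ Nat.card g.ker = p ^ n ∧ Even (m + n) :=
  -- LANDED (F1): Literature/GroupTheory/FiniteAbelian/IsogenyPairParityFinite.lean (worker W1, wave 1)
  Literature.GroupTheory.FiniteAbelian.exists_natCard_ker_eq_pow_and_even_of_adjoint p hT hT' ι hι b b' hb
    hb' hbnd hb'nd f g hgf hfg hadj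

/-- **Stub F2 — the corank of a stable `p`-primary group.** `A` `p`-primary with finite `A[p]`; if the
chain `A[p] ∩ p^{k'} A` is constant for `k' ≥ k`, then `p ^ zpCorank A p = #(A[p] ∩ p^k A)`: with
`C = p^k A` (which is `p`-divisible, `CasselsTateParity.exists_nsmul_eq_of_stable`) and the finite
quotient `T = A/C`, `dim A[p] = dim (A[p] ∩ C) + dim T[p]` (`A[p] ↠ T[p]`), `A/pA ≅ T/pT`
(`modNEquivOfExact`) and `#T/pT = #T[p]` (`natCard_torsionBy_eq_natCard_modN`). Size S/M. [folklore] -/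
theorem stub_zpCorankOfStable
    {A : Type u} [AddCommGroup A] (p : ℕ) [Fact p.Prime]
    (hA : ∀ a : A, ∃ n : ℕ, p ^ n • a = 0) [Finite A[(p : ℤ)]] {k : ℕ}
    (hst : ∀ k', k ≤ k' → A[(p : ℤ)] ⊓ (nsmulAddMonoidHom (α := A) (p ^ k')).range =
      A[(p : ℤ)] ⊓ (nsmulAddMonoidHom (α := A) (p ^ k)).range) :
    p ^ zpCorank A p = Nat.card ↥(A[(p : ℤ)] ⊓ (nsmulAddMonoidHom (α := A) (p ^ k)).range) :=
  -- LANDED (F2): Literature/NumberTheory/EllipticCurves/ZpCorankStable.lean p98446 (worker W2, wave 1)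
  pow_zpCorank_eq_natCard_torsionBy_inf_range_of_stable p hA hst

/-- **Stub F3 — isogeny-pair parity for `p`-primary groups (layer 2: consumes the STATEMENTS of F1 and
F2 as hypotheses).** `A, A'` `p`-primary with finite `p`-torsion, alternating pairings `B, B'` whose left
kernels are `p^∞`-divisible, `f : A → A'`, `g : A' → A` with `g f = p`, `f g = p`, adjoint: then
`#ker f = p^m`, `#ker g = p^n` and `zpCorank A' p + m + n` is even. Proof: common stability index `k` for
both chains (`exists_torsionBy_inf_range_stable`), `C = p^k A`, `C' = p^k A'` (`f C ⊆ C'`, `g C' ⊆ C`,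
both `p`-divisible, both in the kernels of the pairings), finite quotients `T, T'` with induced
non-degenerate alternating pairings and induced adjoint maps `f̄, ḡ` (F1 applies); counting:
`#ker f = #ker f̄ · #(ker f ∩ C)`, `ker f ∩ C = g(C'[p])`, `ker g ∩ C' = f(C[p])`,
`#g(C'[p]) · #f(C[p]) = #C'[p]`, and `p^{zpCorank A'} = #C'[p]` (F2). Size M/L. [folklore] -/
theorem stub_abstractParity
    (hfin : ∀ {T T' : Type u} {Q : Type v} [AddCommGroup T] [AddCommGroup T'] [AddCommGroup Q]
      [Finite T] [Finite T'] (p : ℕ) [Fact p.Prime]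
      (_hT : ∀ t : T, ∃ n : ℕ, p ^ n • t = 0) (_hT' : ∀ t : T', ∃ n : ℕ, p ^ n • t = 0)
      (ι : Q[(p : ℤ)] →+ ZMod p) (_hι : Function.Injective ι)
      (b : T →+ T →+ Q) (b' : T' →+ T' →+ Q)
      (_hb : ∀ x, b x x = 0) (_hb' : ∀ y, b' y y = 0)
      (_hbnd : ∀ x, (∀ y, b x y = 0) → x = 0) (_hb'nd : ∀ x, (∀ y, b' x y = 0) → x = 0)
      (f : T →+ T') (g : T' →+ T)
      (_hgf : ∀ x, g (f x) = p • x) (_hfg : ∀ y, f (g y) = p • y)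
      (_hadj : ∀ x y, b' (f x) y = b x (g y)),
      ∃ m n : ℕ, Nat.card f.ker = p ^ m ∧ Nat.card g.ker = p ^ n ∧ Even (m + n))
    (hzp : ∀ {A : Type u} [AddCommGroup A] (p : ℕ) [Fact p.Prime]
      (_hA : ∀ a : A, ∃ n : ℕ, p ^ n • a = 0) [Finite A[(p : ℤ)]] {k : ℕ}
      (_hst : ∀ k', k ≤ k' → A[(p : ℤ)] ⊓ (nsmulAddMonoidHom (α := A) (p ^ k')).range =
        A[(p : ℤ)] ⊓ (nsmulAddMonoidHom (α := A) (p ^ k)).range),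
      p ^ zpCorank A p = Nat.card ↥(A[(p : ℤ)] ⊓ (nsmulAddMonoidHom (α := A) (p ^ k)).range))
    {A A' : Type u} {Q : Type v} [AddCommGroup A] [AddCommGroup A'] [AddCommGroup Q]
    (p : ℕ) [Fact p.Prime]
    (hA : ∀ a : A, ∃ n : ℕ, p ^ n • a = 0) (hA' : ∀ a : A', ∃ n : ℕ, p ^ n • a = 0)
    [Finite A[(p : ℤ)]] [Finite A'[(p : ℤ)]]
    (ι : Q[(p : ℤ)] →+ ZMod p) (hι : Function.Injective ι)
    (B : A →+ A →+ Q) (B' : A' →+ A' →+ Q) (hB : ∀ x, B x x = 0) (hB' : ∀ y, B' y y = 0)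
    (hker : ∀ a, (∀ b, B a b = 0) → ∀ k : ℕ, a ∈ (nsmulAddMonoidHom (α := A) (p ^ k)).range)
    (hker' : ∀ a, (∀ b, B' a b = 0) → ∀ k : ℕ, a ∈ (nsmulAddMonoidHom (α := A') (p ^ k)).range)
    (f : A →+ A') (g : A' →+ A) (hgf : ∀ x, g (f x) = p • x) (hfg : ∀ y, f (g y) = p • y)
    (hadj : ∀ x y, B' (f x) y = B x (g y)) :
    ∃ m n : ℕ, Nat.card f.ker = p ^ m ∧ Nat.card g.ker = p ^ n ∧ Even (zpCorank A' p + m + n) :=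
  -- LANDED (F3): Literature/NumberTheory/EllipticCurves/IsogenyPairParity.lean p99457 (worker W3, wave 1)
  exists_natCard_ker_even_zpCorank_of_adjoint hfin hzp p hA hA' ι hι B B' hB hB' hker hker' f g hgf hfg hadj

/-- **Stub F4 — the arithmetic wrapper (layer 2: consumes the STATEMENT of F3, closed, and the body of
F5).** From the functorial Cassels–Tate family over `ℚ` and the abstract parity F3 (at universe `0`):
for `E = E_{a,b}`, `V₀` its half-model (`twoIsogenyCodomain_halfModel`), `φ₀ = V₀.twoIsogeny`,
`φ̂₀` its dual (`Isogeny.exists_dual_of_isElliptic`, `deg φ₀ = 2`): restrict `Ш(φ₀)`, `Ш(φ̂₀)` to the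
`2`-primary parts (kernel clause ⇒ `2^∞`-divisibility by the coprime-order argument of
`CasselsTateParity.exists_natCard_modN_primaryComponent_sha`; `φ₀ φ̂₀ = 2` from `φ̂₀ φ₀ = 2` and
`twoIsogenyGeomHom_surjective`), get `corank Ш(E)[2^∞] + m + n` even with `#ker Ш(φ₀) = 2^m`,
`#ker Ш(φ̂₀) = 2^n`; identify `ker Ш(φ̂₀) = ker Ш(φ_E)` (`φ̂₀ = σ ∘ φ_E` on `E(ℚ̄)` by surjectivity of
`φ₀` and `twoIsogenyFun_twoIsogenyFun`, so `ker ⊆` by functoriality of `galH1Map`; `⊇` because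
`φ̂₀ (0,0) = O`, as in `galH1Map_twoIsogenyTorsorClass`, with `range_twoIsogenyTorsorHom_eq_ker_galH1Map`);
conclude with `natCard_sha_inf_range_twoIsogenyTorsorHom_eq` and
`cassels_selmerCorank_two_parity_iff_sha_parity`. Size L. Lead's own stub. -/
theorem stub_casselsOfAbstract
    (habs : ∀ {A A' : Type} {Q : Type} [AddCommGroup A] [AddCommGroup A'] [AddCommGroup Q]
      (p : ℕ) [Fact p.Prime]
      (_hA : ∀ a : A, ∃ n : ℕ, p ^ n • a = 0) (_hA' : ∀ a : A', ∃ n : ℕ, p ^ n • a = 0)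
      [Finite A[(p : ℤ)]] [Finite A'[(p : ℤ)]]
      (ι : Q[(p : ℤ)] →+ ZMod p) (_hι : Function.Injective ι)
      (B : A →+ A →+ Q) (B' : A' →+ A' →+ Q) (_hB : ∀ x, B x x = 0) (_hB' : ∀ y, B' y y = 0)
      (_hker : ∀ a, (∀ b, B a b = 0) → ∀ k : ℕ, a ∈ (nsmulAddMonoidHom (α := A) (p ^ k)).range)
      (_hker' : ∀ a, (∀ b, B' a b = 0) → ∀ k : ℕ, a ∈ (nsmulAddMonoidHom (α := A') (p ^ k)).range)
      (f : A →+ A') (g : A' →+ A) (_hgf : ∀ x, g (f x) = p • x) (_hfg : ∀ y, f (g y) = p • y)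
      (_hadj : ∀ x y, B' (f x) y = B x (g y)),
      ∃ m n : ℕ, Nat.card f.ker = p ^ m ∧ Nat.card g.ker = p ^ n ∧ Even (zpCorank A' p + m + n))
    (hCT : ∃ B : (W : WeierstrassCurve ℚ) → (W.sha →+ W.sha →+ AddCircle (1 : ℚ)),
      (∀ (W : WeierstrassCurve ℚ) [W.IsElliptic],
        (∀ x, B W x x = 0) ∧ ∀ x, (∀ y, B W x y = 0) ↔ x ∈ AddSubgroup.divisibleElements W.sha) ∧
      ∀ (W W' : WeierstrassCurve ℚ) [W.IsElliptic] [W'.IsElliptic] (φ : Isogeny W W') (ψ : Isogeny W' W),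
        (∀ P, ψ (φ P) = (φ.degree : ℤ) • P) →
        ∀ (x : W.sha) (y : W'.sha),
          B W' (shaMap φ.toAddMonoidHom φ.map_smul φ.hasLocalPointsMaps_toAddMonoidHom x) y =
            B W x (shaMap ψ.toAddMonoidHom ψ.map_smul ψ.hasLocalPointsMaps_toAddMonoidHom y)) :
    cassels_selmerCorank_two_parity :=
  -- LANDED (F4, lead): Literature/NumberTheory/EllipticCurves/TwoIsogenyCasselsParity.lean (with
  -- CasselsTateIsogenyParity.lean p99900 and TwoIsogenyDualKernel.lean p99051)
  cassels_selmerCorank_two_parity_of_casselsTate_functorial habs hCT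

/-- **Stub F5 — the Cassels–Tate pairing as a functorial family over `ℚ` (the ONE deep input; body
of the named fact-to-be `casselsTate_pairing_functorial`).** There is a family of bi-additive pairings
`⟨·,·⟩_W : Ш(W/ℚ) × Ш(W/ℚ) → ℚ/ℤ`, one for each elliptic `W`, each alternating with kernel exactly the
divisible subgroup (Cassels 1962; Tate 1963; Milne, *ADT*, I, Prop. 6.9 and Thm. 6.13(a); Silverman,
*AEC*, Thm. X.4.14 — this part is the tree's `WeierstrassCurve.exists_casselsTate_pairing`), and
FUNCTORIAL for isogenies: `⟨φ x, y⟩_{W'} = ⟨x, φ̂ y⟩_W` for an isogeny `φ : W → W'` with dual `φ̂`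
(`φ̂ φ = deg φ`) — Milne, *ADT*, I, Rem. 6.10(a) (`⟨f(a), b⟩ = ⟨a, f^t(b)⟩`, "the local pairings are
functorial"), with `E^t = E`, `φ^t = φ̂` for elliptic curves (Silverman, *AEC*, III.6.1). NOT to be
attacked by a worker: it closes the day that fact is discharged (Tate local duality + Poitou–Tate);
`blocked-on` it otherwise. Size XL / 0 granted the fact. -/
theorem stub_ctFunctorial :
    ∃ B : (W : WeierstrassCurve ℚ) → (W.sha →+ W.sha →+ AddCircle (1 : ℚ)),
      (∀ (W : WeierstrassCurve ℚ) [W.IsElliptic],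
        (∀ x, B W x x = 0) ∧ ∀ x, (∀ y, B W x y = 0) ↔ x ∈ AddSubgroup.divisibleElements W.sha) ∧
      ∀ (W W' : WeierstrassCurve ℚ) [W.IsElliptic] [W'.IsElliptic] (φ : Isogeny W W') (ψ : Isogeny W' W),
        (∀ P, ψ (φ P) = (φ.degree : ℤ) • P) →
        ∀ (x : W.sha) (y : W'.sha),
          B W' (shaMap φ.toAddMonoidHom φ.map_smul φ.hasLocalPointsMaps_toAddMonoidHom x) y =
            B W x (shaMap ψ.toAddMonoidHom ψ.map_smul ψ.hasLocalPointsMaps_toAddMonoidHom y) := by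
  sorry

/-- Cassels' parity formula for the `2`-isogeny — the tree's named fact
`cassels_selmerCorank_two_parity` — from the five stubs F1–F5 (pure composition). -/
theorem cassels_of_stubs : cassels_selmerCorank_two_parity := by
  refine stub_casselsOfAbstract ?_ stub_ctFunctorial
  intro A A' Q _ _ _ p _ hA hA' _ _ ι hι B B' hB hB' hker hker' f g hgf hfg hadj
  exact stub_abstractParity.{0, 0} stub_finiteLevel stub_zpCorankOfStable p hA hA' ι hι B B' hB hB'
    hker hker' f g hgf hfg hadj

end CasselsParity

/-! ## Stub F is the named fact restricted to the pencil (proved reduction) -/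

/-- `b (a² − 4b) ≠ 0` for `(a, b) = (2t, t²+1)`: it is `−4 (t²+1)`. -/
theorem pencil_ne_zero (t : ℕ) :
    ((t : ℤ) ^ 2 + 1) * ((2 * (t : ℤ)) ^ 2 - 4 * ((t : ℤ) ^ 2 + 1)) ≠ 0 := by
  have e : (2 * (t : ℤ)) ^ 2 - 4 * ((t : ℤ) ^ 2 + 1) = -4 := by ring
  rw [e]
  exact mul_ne_zero (by positivity) (by norm_num)

/-- Stub F follows in one line from the tree's named fact `cassels_selmerCorank_two_parity`. -/
theorem casselsPencil_of_fact (h : cassels_selmerCorank_two_parity) :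
    ∀ t : ℕ, 1 ≤ t →
      (-1 : ℤ) ^ (⟨0, 2 * (t : ℚ), 0, (t : ℚ) ^ 2 + 1, 0⟩ : WeierstrassCurve ℚ).selmerCorank 2 =
        (-1 : ℤ) ^ (twoIsogenySelmerRank (2 * (t : ℤ)) ((t : ℤ) ^ 2 + 1) +
          twoIsogenySelmerRank' (2 * (t : ℤ)) ((t : ℤ) ^ 2 + 1)) := by
  intro t _
  have key := h (2 * (t : ℤ)) ((t : ℤ) ^ 2 + 1) (pencil_ne_zero t)
  push_cast at key
  exact key

/-! ## Proved helpers -/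

/-- The real place on the `b`-side: for `d < 0` (hence `d′ = (t²+1)/d < 0`) the form
`d u⁴ + 2t u²z² + d′ z⁴` is negative definite (`d · q = (d u² + t z²)² + z⁴`), so `w² = q` has no real
point. (The tree's `not_isSoluble_real_twoIsogenyQuartic_of_neg` needs `a ≤ 0` and does not apply —
triage r1-2 sharpening.) -/
theorem real_obstruction (t : ℕ) {d : ℤ} (hd : d < 0) (hdvd : d ∣ (t : ℤ) ^ 2 + 1) :
    ¬ ((twoIsogenyQuartic (2 * (t : ℤ)) d (((t : ℤ) ^ 2 + 1) / d)).map
        (Int.castRingHom ℝ)).IsSoluble := by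
  rintro ⟨u, z, w, h0, h⟩
  have hdd' : d * (((t : ℤ) ^ 2 + 1) / d) = (t : ℤ) ^ 2 + 1 := Int.mul_ediv_cancel' hdvd
  rw [eval_map_twoIsogenyQuartic] at h
  simp only [eq_intCast] at h
  push_cast at h
  have hdd'R : (d : ℝ) * ((((t : ℤ) ^ 2 + 1) / d : ℤ) : ℝ) = (t : ℝ) ^ 2 + 1 := by
    exact_mod_cast hdd'
  have hdR : (d : ℝ) < 0 := by exact_mod_cast hd
  have key : (d : ℝ) * w ^ 2 = ((d : ℝ) * u ^ 2 + (t : ℝ) * z ^ 2) ^ 2 + z ^ 4 := by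
    rw [h]
    linear_combination (z ^ 4) * hdd'R
  have hneg : (d : ℝ) * w ^ 2 ≤ 0 := mul_nonpos_of_nonpos_of_nonneg hdR.le (sq_nonneg w)
  have hz : z = 0 := by
    by_contra hz
    have hz4 : 0 < z ^ 4 := Even.pow_pos ⟨2, rfl⟩ hz
    nlinarith [sq_nonneg ((d : ℝ) * u ^ 2 + (t : ℝ) * z ^ 2)]
  subst hz
  have hu : u = 0 := by
    by_contra hu
    have hu4 : 0 < u ^ 4 := Even.pow_pos ⟨2, rfl⟩ hu
    have hd2 : 0 < (d : ℝ) * d := mul_pos_of_neg_of_neg hdR hdR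
    nlinarith [mul_pos hd2 hu4]
  subst hu
  rcases h0 with h0 | h0 <;> exact h0 rfl

/-- An odd prime factor of `t² + 1` is `≡ 1 (mod 4)` (`−1 ≡ t²` is a square mod `p`). -/
theorem mod_four_of_dvd (t : ℕ) {p : ℕ} (hp : p.Prime) (hp2 : p ≠ 2) (hdvd : p ∣ t ^ 2 + 1) :
    p % 4 = 1 := by
  haveI := Fact.mk hp
  have hsq : IsSquare (-1 : ZMod p) := by
    refine ⟨(t : ZMod p), ?_⟩
    have h0 : ((t ^ 2 + 1 : ℕ) : ZMod p) = 0 := (ZMod.natCast_eq_zero_iff _ _).mpr hdvd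
    push_cast at h0
    linear_combination -h0
  have h4 := ZMod.exists_sq_eq_neg_one_iff.mp hsq
  rcases hp.eq_two_or_odd with h | h
  · exact absurd h hp2
  · omega

/-- `4` is not squarefree in `ℤ`. -/
theorem not_squarefree_four : ¬ Squarefree (4 : ℤ) := fun h => by
  have h2 := h 2 ⟨1, by norm_num⟩
  rw [Int.isUnit_iff] at h2
  omega

/-- `−4` is not squarefree in `ℤ`. -/
theorem not_squarefree_neg_four : ¬ Squarefree (-4 : ℤ) := fun h => by
  have h2 := h 2 ⟨-1, by norm_num⟩
  rw [Int.isUnit_iff] at h2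
  omega

/-- Powers of `−1` only see the exponent mod `2`. -/
theorem neg_one_pow_congr {m n : ℕ} (h : m % 2 = n % 2) : (-1 : ℤ) ^ m = (-1 : ℤ) ^ n := by
  rw [neg_one_pow_eq_pow_mod_two (R := ℤ) (n := m), h, ← neg_one_pow_eq_pow_mod_two]

/-! ## The composition: local data + count + Cassels ⇒ the pointwise dictionary -/

/-- **The glue, fully proved.** Hypotheses = the six stub statements verbatim; conclusion = the crux
identity at `t` with the sharp periodic factor `w t = if t % 4 < 2 then −1 else 1`.
Steps: `S(2t, t²+1) = {d ∈ [1, t²+1] : squarefree, d ∣ t²+1, table}` (real obstruction + Stubs A, C),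
hence `dim S = ω − r` (Stub E, `Nat.log_pow`); `S′ = S(−4t, −4) ⊆ {±1, ±2}` contains `±1`
(images of `O`, `T′`), and `2 ∈ S′ ↔ −2 ∈ S′` (translation by the class `−1`, tree
`isSoluble_map_twoIsogenyQuartic_of_mul_eq`) `↔ (t ≡ 0 (4) ∨ t ≡ 7 (8)) ∧ ¬β` (Stubs B, D), hence
`dim S′ ∈ {1, 2}`; Stub F; a parity check on `t mod 8 × β`. -/
theorem dictionary_of_localData
    (hA : ∀ t : ℕ, 1 ≤ t → ∀ d : ℤ, 0 < d → Squarefree d → d ∣ (t : ℤ) ^ 2 + 1 →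
      ∀ (p : ℕ) [Fact p.Prime], p ≠ 2 →
        ((twoIsogenyQuartic (2 * (t : ℤ)) d (((t : ℤ) ^ 2 + 1) / d)).map
          (Int.castRingHom ℚ_[p])).IsSoluble)
    (hB : ∀ t : ℕ, 1 ≤ t → ∀ (p : ℕ) [Fact p.Prime], p ≠ 2 →
      (((twoIsogenyQuartic (-4 * (t : ℤ)) 2 (-2)).map (Int.castRingHom ℚ_[p])).IsSoluble ↔
        (p ∣ t ^ 2 + 1 → p % 8 = 1)))
    (hC : ∀ t : ℕ, 1 ≤ t → ∀ d : ℤ, 0 < d → Squarefree d → d ∣ (t : ℤ) ^ 2 + 1 →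
      (((twoIsogenyQuartic (2 * (t : ℤ)) d (((t : ℤ) ^ 2 + 1) / d)).map
          (Int.castRingHom ℚ_[2])).IsSoluble ↔
        ((d % 2 = 1 ∧ (d % 8 = 1 ∨ (d % 8 = 5 ∧ (t % 4 = 1 ∨ t % 4 = 2)))) ∨
          (d % 2 = 0 ∧ ((d / 2 % 8 = 1 ∧ (t % 4 = 1 ∨ t % 8 = 7)) ∨
            (d / 2 % 8 = 5 ∧ (t % 4 = 1 ∨ t % 8 = 3)))))))
    (hD : ∀ t : ℕ, 1 ≤ t →
      (((twoIsogenyQuartic (-4 * (t : ℤ)) 2 (-2)).map (Int.castRingHom ℚ_[2])).IsSoluble ↔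
        (t % 4 = 0 ∨ t % 8 = 7)))
    (hE : ∀ t : ℕ, 1 ≤ t →
      ((Finset.Icc (1 : ℤ) ((t : ℤ) ^ 2 + 1)).filter (fun d : ℤ =>
          Squarefree d ∧ d ∣ (t : ℤ) ^ 2 + 1 ∧
            ((d % 2 = 1 ∧ (d % 8 = 1 ∨ (d % 8 = 5 ∧ (t % 4 = 1 ∨ t % 4 = 2)))) ∨
              (d % 2 = 0 ∧ ((d / 2 % 8 = 1 ∧ (t % 4 = 1 ∨ t % 8 = 7)) ∨
                (d / 2 % 8 = 5 ∧ (t % 4 = 1 ∨ t % 8 = 3))))))).card =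
        2 ^ ((t ^ 2 + 1).primeFactors.card -
          (if t % 8 = 3 ∨ ((t % 4 = 0 ∨ t % 8 = 7) ∧ ∃ p ∈ (t ^ 2 + 1).primeFactors, p % 8 = 5)
            then 1 else 0)))
    (hF : ∀ t : ℕ, 1 ≤ t →
      (-1 : ℤ) ^ (⟨0, 2 * (t : ℚ), 0, (t : ℚ) ^ 2 + 1, 0⟩ : WeierstrassCurve ℚ).selmerCorank 2 =
        (-1 : ℤ) ^ (twoIsogenySelmerRank (2 * (t : ℤ)) ((t : ℤ) ^ 2 + 1) +
          twoIsogenySelmerRank' (2 * (t : ℤ)) ((t : ℤ) ^ 2 + 1)))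
    (t : ℕ) (ht : 1 ≤ t) :
    (-1 : ℤ) ^ (⟨0, 2 * (t : ℚ), 0, (t : ℚ) ^ 2 + 1, 0⟩ : WeierstrassCurve ℚ).selmerCorank 2 =
      -((if t % 4 < 2 then (-1 : ℤ) else 1) *
        (-1 : ℤ) ^ (((t ^ 2 + 1).primeFactors.filter (fun p : ℕ => p ≠ 2)).card)) := by
  have hb0 : (0 : ℤ) < (t : ℤ) ^ 2 + 1 := by positivity
  have hbne : (t : ℤ) ^ 2 + 1 ≠ 0 := hb0.ne'
  ------------------------------------------------------------------------------------------------
  -- `b`-side: the Selmer set is the explicit filter, so its dimension is `ω − r`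
  ------------------------------------------------------------------------------------------------
  have hS : twoIsogenySelmerGroup (2 * (t : ℤ)) ((t : ℤ) ^ 2 + 1) =
      (Finset.Icc (1 : ℤ) ((t : ℤ) ^ 2 + 1)).filter (fun d : ℤ =>
          Squarefree d ∧ d ∣ (t : ℤ) ^ 2 + 1 ∧
            ((d % 2 = 1 ∧ (d % 8 = 1 ∨ (d % 8 = 5 ∧ (t % 4 = 1 ∨ t % 4 = 2)))) ∨
              (d % 2 = 0 ∧ ((d / 2 % 8 = 1 ∧ (t % 4 = 1 ∨ t % 8 = 7)) ∨
                (d / 2 % 8 = 5 ∧ (t % 4 = 1 ∨ t % 8 = 3)))))) := by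
    ext d
    simp only [Finset.mem_filter, Finset.mem_Icc]
    constructor
    · intro hd
      obtain ⟨hsq, hdvd, hR, hP⟩ := (mem_twoIsogenySelmerGroup_iff hbne).mp hd
      have hdpos : 0 < d := by
        rcases lt_or_gt_of_ne hsq.ne_zero with hneg | hpos
        · exact absurd hR (real_obstruction t hneg hdvd)
        · exact hpos
      exact ⟨⟨hdpos, Int.le_of_dvd hb0 hdvd⟩, hsq, hdvd, (hC t ht d hdpos hsq hdvd).mp (hP 2)⟩
    · rintro ⟨⟨hd1, -⟩, hsq, hdvd, htab⟩
      have hdpos : 0 < d := by omega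
      rw [mem_twoIsogenySelmerGroup_iff_of_pos hbne hdpos]
      refine ⟨hsq, hdvd, fun p hp => ?_⟩
      by_cases hp2 : p = 2
      · subst hp2
        exact (hC t ht d hdpos hsq hdvd).mpr htab
      · exact hA t ht d hdpos hsq hdvd p hp2
  have hrank : twoIsogenySelmerRank (2 * (t : ℤ)) ((t : ℤ) ^ 2 + 1) =
      (t ^ 2 + 1).primeFactors.card -
        (if t % 8 = 3 ∨ ((t % 4 = 0 ∨ t % 8 = 7) ∧ ∃ p ∈ (t ^ 2 + 1).primeFactors, p % 8 = 5)
          then 1 else 0) := by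
    rw [twoIsogenySelmerRank, hS, hE t ht, Nat.log_pow Nat.one_lt_two]
  ------------------------------------------------------------------------------------------------
  -- dual side: `S′ = S(−4t, −4) ∈ { {±1}, {±1, ±2} }`
  ------------------------------------------------------------------------------------------------
  have h4ne : (-4 : ℤ) ≠ 0 := by norm_num
  have hab' : (-4 : ℤ) * ((-4 * (t : ℤ)) ^ 2 - 4 * (-4)) ≠ 0 := by
    have e : (-4 * (t : ℤ)) ^ 2 - 4 * (-4) = 16 * ((t : ℤ) ^ 2 + 1) := by ring
    rw [e]
    exact mul_ne_zero h4ne (mul_ne_zero (by norm_num) hbne)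
  have hS'eq : twoIsogenySelmerGroup' (2 * (t : ℤ)) ((t : ℤ) ^ 2 + 1) =
      twoIsogenySelmerGroup (-4 * (t : ℤ)) (-4) := by
    rw [twoIsogenySelmerGroup'_eq]
    congr 1 <;> ring
  have h1 : (1 : ℤ) ∈ twoIsogenySelmerGroup (-4 * (t : ℤ)) (-4) :=
    one_mem_twoIsogenySelmerGroup _ h4ne
  have hm1 : (-1 : ℤ) ∈ twoIsogenySelmerGroup (-4 * (t : ℤ)) (-4) :=
    mem_twoIsogenySelmerGroup_of_isSquare h4ne isUnit_one.neg.squarefree (by norm_num)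
      ⟨2, by norm_num⟩
  have hsub : ∀ d ∈ twoIsogenySelmerGroup (-4 * (t : ℤ)) (-4),
      d = -2 ∨ d = -1 ∨ d = 1 ∨ d = 2 := by
    intro d hd
    have hsq := squarefree_of_mem_twoIsogenySelmerGroup hd
    have hdvd : d ∣ 4 := dvd_neg.mp (dvd_of_mem_twoIsogenySelmerGroup hd)
    have hle : d ≤ 4 := Int.le_of_dvd (by norm_num) hdvd
    have hge : -4 ≤ d := by
      have := Int.le_of_dvd (by norm_num) (neg_dvd.mpr hdvd)
      omega
    have h0 := hsq.ne_zero
    interval_cases d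
    · exact absurd hsq not_squarefree_neg_four
    · exfalso; norm_num at hdvd
    · exact Or.inl rfl
    · exact Or.inr (Or.inl rfl)
    · exact absurd rfl h0
    · exact Or.inr (Or.inr (Or.inl rfl))
    · exact Or.inr (Or.inr (Or.inr rfl))
    · exfalso; norm_num at hdvd
    · exact absurd hsq not_squarefree_four
  -- the class `−1` is soluble everywhere (`(−4)/(−1) = 2²`: the point `(0:1:2)`)
  have e41 : (-4 : ℤ) / -1 = 2 ^ 2 := by norm_num
  have hm1F : ∀ (F : Type) [Field F],
      ((twoIsogenyQuartic (-4 * (t : ℤ)) (-1) ((-4) / (-1))).map (Int.castRingHom F)).IsSoluble := by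
    intro F _
    rw [e41]
    exact isSoluble_map_twoIsogenyQuartic_of_sq_right _ _ _ _
  have hneg2 : (-2 : ℤ) ∈ twoIsogenySelmerGroup (-4 * (t : ℤ)) (-4) ↔
      (2 : ℤ) ∈ twoIsogenySelmerGroup (-4 * (t : ℤ)) (-4) := by
    rw [mem_twoIsogenySelmerGroup_iff h4ne, mem_twoIsogenySelmerGroup_iff h4ne]
    constructor
    · rintro ⟨-, -, hR, hP⟩
      refine ⟨Int.prime_two.squarefree, by norm_num, ?_, fun p hp => ?_⟩
      · exact isSoluble_map_twoIsogenyQuartic_of_mul_eq hab' (d₁ := -1) (d₂ := -2) (d₃ := 2)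
          (m := 1) (by norm_num) (by norm_num) (by norm_num) (by norm_num) (hm1F ℝ) hR
      · exact isSoluble_map_twoIsogenyQuartic_of_mul_eq hab' (d₁ := -1) (d₂ := -2) (d₃ := 2)
          (m := 1) (by norm_num) (by norm_num) (by norm_num) (by norm_num) (hm1F ℚ_[p]) (hP p)
    · rintro ⟨-, -, hR, hP⟩
      refine ⟨Int.prime_two.neg.squarefree, by norm_num, ?_, fun p hp => ?_⟩
      · exact isSoluble_map_twoIsogenyQuartic_of_mul_eq hab' (d₁ := -1) (d₂ := 2) (d₃ := -2)
          (m := 1) (by norm_num) (by norm_num) (by norm_num) (by norm_num) (hm1F ℝ) hR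
      · exact isSoluble_map_twoIsogenyQuartic_of_mul_eq hab' (d₁ := -1) (d₂ := 2) (d₃ := -2)
          (m := 1) (by norm_num) (by norm_num) (by norm_num) (by norm_num) (hm1F ℚ_[p]) (hP p)
  -- the class `2`: Stubs B (odd places) and D (the place 2); the real place is free (`2 > 0`)
  have h2iff : (2 : ℤ) ∈ twoIsogenySelmerGroup (-4 * (t : ℤ)) (-4) ↔
      ((t % 4 = 0 ∨ t % 8 = 7) ∧ ¬ ∃ p ∈ (t ^ 2 + 1).primeFactors, p % 8 = 5) := by
    rw [mem_twoIsogenySelmerGroup_iff_of_pos h4ne (by norm_num : (0 : ℤ) < 2)]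
    have e42 : (-4 : ℤ) / 2 = -2 := by norm_num
    rw [e42]
    constructor
    · rintro ⟨-, -, hloc⟩
      refine ⟨(hD t ht).mp (hloc 2), ?_⟩
      rintro ⟨p, hp, hp5⟩
      obtain ⟨hpp, hpdvd, -⟩ := Nat.mem_primeFactors.mp hp
      have hp2 : p ≠ 2 := by omega
      haveI : Fact p.Prime := ⟨hpp⟩
      have h81 := (hB t ht p hp2).mp (hloc p) hpdvd
      omega
    · rintro ⟨h2, hB5⟩
      refine ⟨Int.prime_two.squarefree, by norm_num, fun p hp => ?_⟩
      by_cases hp2 : p = 2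
      · subst hp2
        exact (hD t ht).mpr h2
      · refine (hB t ht p hp2).mpr fun hpdvd => ?_
        have h41 := mod_four_of_dvd t hp.out hp2 hpdvd
        by_contra h81
        exact hB5 ⟨p, Nat.mem_primeFactors.mpr ⟨hp.out, hpdvd, by positivity⟩, by omega⟩
  have hcardT : (twoIsogenySelmerGroup (-4 * (t : ℤ)) (-4)).card =
      if (2 : ℤ) ∈ twoIsogenySelmerGroup (-4 * (t : ℤ)) (-4) then 4 else 2 := by
    split_ifs with h2
    · have hT : twoIsogenySelmerGroup (-4 * (t : ℤ)) (-4) = {-2, -1, 1, 2} := by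
        ext d
        simp only [Finset.mem_insert, Finset.mem_singleton]
        refine ⟨hsub d, fun h => ?_⟩
        rcases h with rfl | rfl | rfl | rfl
        · exact hneg2.mpr h2
        · exact hm1
        · exact h1
        · exact h2
      rw [hT]
      decide
    · have hT : twoIsogenySelmerGroup (-4 * (t : ℤ)) (-4) = {-1, 1} := by
        ext d
        simp only [Finset.mem_insert, Finset.mem_singleton]
        refine ⟨fun hd => ?_, fun h => ?_⟩
        · rcases hsub d hd with rfl | rfl | rfl | rfl
          · exact absurd (hneg2.mp hd) h2
          · exact Or.inl rfl
          · exact Or.inr rfl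
          · exact absurd hd h2
        · rcases h with rfl | rfl
          · exact hm1
          · exact h1
      rw [hT]
      decide
  have hrank' : twoIsogenySelmerRank' (2 * (t : ℤ)) ((t : ℤ) ^ 2 + 1) =
      if (2 : ℤ) ∈ twoIsogenySelmerGroup (-4 * (t : ℤ)) (-4) then 2 else 1 := by
    rw [twoIsogenySelmerRank'_eq, hS'eq, hcardT]
    split_ifs
    · exact Nat.log_eq_of_pow_le_of_lt_pow (by norm_num) (by norm_num)
    · exact Nat.log_eq_of_pow_le_of_lt_pow (by norm_num) (by norm_num)
  ------------------------------------------------------------------------------------------------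
  -- `ω` versus `ω_odd`, and `ω ≥ 1`
  ------------------------------------------------------------------------------------------------
  have h2mem : 2 ∈ (t ^ 2 + 1).primeFactors ↔ t % 2 = 1 := by
    rw [Nat.mem_primeFactors]
    constructor
    · rintro ⟨-, ⟨k, hk⟩, -⟩
      by_contra hev
      obtain ⟨m, hm⟩ : 2 ∣ t := Nat.dvd_of_mod_eq_zero (by omega)
      have : t ^ 2 = 2 * (2 * m ^ 2) := by rw [hm]; ring
      omega
    · intro hodd
      refine ⟨Nat.prime_two, ?_, by positivity⟩
      obtain ⟨k, hk⟩ : ∃ k, t = 2 * k + 1 := ⟨t / 2, by omega⟩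
      exact ⟨2 * k ^ 2 + 2 * k + 1, by rw [hk]; ring⟩
  have hfilt : (t ^ 2 + 1).primeFactors.filter (fun p : ℕ => p ≠ 2) =
      (t ^ 2 + 1).primeFactors.erase 2 := by
    ext p
    simp only [Finset.mem_filter, Finset.mem_erase]
    exact and_comm
  have hω1 : 1 ≤ (t ^ 2 + 1).primeFactors.card := by
    have h1t : 1 ≤ t ^ 2 := Nat.one_le_pow _ _ ht
    exact Finset.card_pos.mpr (Nat.nonempty_primeFactors.mpr (by omega))
  have hωodd : t % 2 = 1 →
      ((t ^ 2 + 1).primeFactors.filter (fun p : ℕ => p ≠ 2)).card + 1 =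
        (t ^ 2 + 1).primeFactors.card := by
    intro hodd
    rw [hfilt, Finset.card_erase_of_mem (h2mem.mpr hodd)]
    omega
  have hωeven : t % 2 = 0 →
      ((t ^ 2 + 1).primeFactors.filter (fun p : ℕ => p ≠ 2)).card =
        (t ^ 2 + 1).primeFactors.card := by
    intro hev
    rw [hfilt, Finset.erase_eq_of_notMem]
    intro h
    have := h2mem.mp h
    omega
  ------------------------------------------------------------------------------------------------
  -- assemble: Cassels + the two dimensions, then a parity check on `t mod 8 × β`
  ------------------------------------------------------------------------------------------------
  have rhs_eq : -((if t % 4 < 2 then (-1 : ℤ) else 1) *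
        (-1 : ℤ) ^ (((t ^ 2 + 1).primeFactors.filter (fun p : ℕ => p ≠ 2)).card)) =
      (-1 : ℤ) ^ (((t ^ 2 + 1).primeFactors.filter (fun p : ℕ => p ≠ 2)).card +
        if t % 4 < 2 then 0 else 1) := by
    split_ifs <;> ring
  rw [hF t ht, hrank, hrank', rhs_eq]
  apply neg_one_pow_congr
  simp only [h2iff]
  rcases Nat.even_or_odd' t with ⟨k, hk | hk⟩
  · -- `t` even: `ω_odd = ω`
    have hωe := hωeven (by omega)
    by_cases hβ : ∃ p ∈ (t ^ 2 + 1).primeFactors, p % 8 = 5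
    · simp only [hβ, and_true, not_true_eq_false, and_false, if_false]
      split_ifs <;> omega
    · simp only [hβ, and_false, or_false, not_false_eq_true, and_true]
      split_ifs <;> omega
  · -- `t` odd: `ω_odd + 1 = ω`
    have hωo := hωodd (by omega)
    by_cases hβ : ∃ p ∈ (t ^ 2 + 1).primeFactors, p % 8 = 5
    · simp only [hβ, and_true, not_true_eq_false, and_false, if_false]
      split_ifs <;> omega
    · simp only [hβ, and_false, or_false, not_false_eq_true, and_true]
      split_ifs <;> omega

/-! ## The skeleton theorem: concludes the crux BY NAME, no hypotheses (stubs enter as constants) -/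

/-- **`PencilSelmerDictionary` from the six stubs.** Witness `M = 2`,
`w t = if t % 4 < 2 then −1 else 1` (period `4 = 2²`; cdisprove's forced table). The only `sorry`s in
its closure are the six `stub_*` above; when they land this term IS the crux proof. -/
theorem PencilSelmerDictionary_of : PencilSelmerDictionary := by
  refine ⟨2, fun t => if t % 4 < 2 then -1 else 1, fun t => ?_, fun t ht => ?_⟩
  · show (if (t + 2 ^ 2) % 4 < 2 then (-1 : ℤ) else 1) = if t % 4 < 2 then -1 else 1
    rw [show (t + 2 ^ 2) % 4 = t % 4 by norm_num]
  · exact dictionary_of_localData stub_bSideOddPlaces stub_dualSideOddPlaces stub_bSideTwoAdic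
      stub_dualSideTwoAdic stub_twoAdicKernelCount (casselsPencil_of_fact cassels_of_stubs) t ht

end Summit.Parity.BatemanHorn.Cruxes.PencilSelmerDictionary.ToricNodeVacuityCassels

end
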